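import Literature.NumberTheory.GaloisRepresentations.UniversalDeformationHeckeAlgebra
import Literature.NumberTheory.GaloisRepresentations.ModPGaloisRep
import Literature.NumberTheory.GaloisRepresentations.ResidualGaloisRep
import HarnessLib

/-!
# Existence of the universal deformation Hecke algebra `T^Σ_𝔪ρ̄ ≅ R_Σ(ρ̄)` under the Taylor–Wiles
# hypothesis of Fouquet–Wan (Assumption 2.1) — the CONSTRUCTION STATEMENT, as a named fact

Topic `NumberTheory/GaloisRepresentations`; companion of `UniversalDeformationHeckeAlgebra.lean` (the
interface, definition item `defn-UniversalDeformationHeckeAlgebra`, whose requester asked for "structure +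
axioms, construction statement separate"). This file holds the construction statement: ONE named fact
(D-0014, nothing proved — completed cohomology with its Hecke action at `𝔪_ρ̄`, Carayol's
representation and the `R = T` theorems are not available as theorems of the tree), plus two
DEFINITIONS with bodies transcribing [FouquetWan2021, Assumption 2.1].

## The printed statements ([FouquetWan2021] = arXiv:2107.13726v3, §2; [corpus: paper-arxiv-2107.13726])

* §2.1 (p. 12): `p` odd (abstract, p. 1: "Let `p` be an odd prime"); `Σ ∋ p` finite;
  "`ρ̄ : G_{ℚ,Σ} → GL₂(𝔽)` an absolutely irreducible and modular (hence odd) Galois representation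
  unramified outside `Σ`"; `U` allowable ("there exists a (necessarily unique) maximal ideal `𝔪_ρ̄` … such
  that `T(ℓ) mod 𝔪_ρ̄ = tr ρ̄(Fr(ℓ))`, `S(ℓ) mod 𝔪_ρ̄ = det ρ̄(Fr(ℓ))` for all `ℓ ∉ Σ`") and sufficiently
  small; `T^Σ_𝔪ρ̄`; "[Carayol] there exists a `T^Σ_𝔪ρ̄`-module `T_Σ` free of rank 2 … `ρ_Σ` … uniquely
  characterized up to isomorphism by the requirement that `tr(ρ_Σ(Fr(ℓ))) = T(ℓ)` for all `ℓ ∉ Σ`."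
* **Assumption 2.1** (p. 13): "The `G_{ℚ,Σ}`-representation `ρ̄` satisfies the following properties.
  • If `p* = (−1)^{(p−1)/2} p`, then `ρ̄|G_{ℚ(√p*)}` is absolutely irreducible. • If `ρ̄|G_{ℚ_p}` is an
  extension `0 → χ₁ → ρ̄|G_{ℚ_p} → χ₂ → 0`, then `χ₁⁻¹χ₂ ∉ {1, χ̄_cyc}`."
* **Prop. 2.4** (p. 14): "The universal deformation ring `R_Σ(ρ̄)` is a flat `𝒪`-algebra which is a
  complete intersection ring of Krull dimension 4." **Cor. 2.5** (p. 15): "… In particular, the ring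
  `R_Σ(ρ̄)` is reduced." **Prop. 2.6** (p. 16): "The set of primes classical up to a twist is
  Zariski-dense in `Spec R_Σ(ρ̄)`. In particular, `R_Σ(ρ̄)` and `T^Σ_𝔪ρ̄` are isomorphic." (all under
  Assumption 2.1; p. 14: "It follows from … that `D_ρ̄` is representable by a complete, local, noetherian
  ring `R_Σ(ρ̄)` … there is a map `R_Σ(ρ̄) → T^Σ_𝔪ρ̄` which is surjective").
* [Fouquet2025EquivariantTNC] §2.4.1 (p. 15), under Ass. 2.9 (image of `ρ̄` contains a conjugate of
  `SL₂(𝔽_p)`; the same local condition): `T^Σ_𝔪ρ̄ = lim←_{U_p} T(U_pU^{(p)})_{𝔪ρ̄}` "does not depend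
  on the weight `k`", carries `T_Σ` with residual representation `ρ̄`, "Motivic points of `T^Σ_𝔪ρ̄` form
  a Zariski-dense set. The ring `T^Σ_𝔪ρ̄` is the universal deformation ring representing deformations of
  `ρ̄` unramified outside `Σ` and which are attached to eigencuspforms for `U^{(p)}` at de Rham points."
  (there `U^{(p)}` is not necessarily sufficiently small, whence the extra condition). The
  UNCONDITIONED `R_Σ(ρ̄) ≅ T^Σ_𝔪ρ̄` packaged in the interface field `existsUnique_point_of_deformation`
  rests on [FouquetWan2021] Prop. 2.6 (allowable, sufficiently small `U`) ALONE; [Fouquet2025EquivariantTNC]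
  is cited for "all levels at `p` / weight-independence" and the density of motivic points.

## What is here

* `galSqrtPStar p ≤ Γ_ℚ` — the subgroup `G_{ℚ(√p*)}`: the kernel of the unique quadratic character of
  `Gal(ℚ(ζ_p)/ℚ) ≅ 𝔽_p^×`, i.e. of `σ ↦ χ̄_cyc(σ)^{(p−1)/2}` (tree `modPCyclotomicCharacterZMod`), whose
  fixed field is the quadratic subfield `ℚ(√p*)` of `ℚ(ζ_p)` (`p` odd).
* `FouquetWan2021Assumption21 p ρ̄` — Assumption 2.1, clause (1) verbatim and clause (2) in its
  absolute (stronger) form: (1) `ρ̄|_{G_{ℚ(√p*)}}` absolutely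
  irreducible (tree `IsAbsIrreducible` on the restricted homomorphism, the idiom of
  `CalegariEvenFontaineMazurTwo`); (2) for the place `v ∣ p`, every frame `P` and characters
  `χ₁, χ₂` of `Γ_{ℚ_p}` with `P⁻¹ ρ̄|_{Γ_{ℚ_p}} P = (χ₁ * ; 0 χ₂)` (so `χ₁` is the SUB, `χ₂` the
  quotient: "`0 → χ₁ → ρ̄|G_{ℚ_p} → χ₂ → 0`") satisfy `χ₁⁻¹χ₂ ≠ 1` and `χ₁⁻¹χ₂ ≠ χ̄_cyc|_{Γ_{ℚ_p}}`
  (`χ̄_cyc` = tree `modPCyclotomicCharacterZMod`, read in the coefficient field through a ring map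
  `ZMod p →+* k'`; `Γ_{ℚ_p} → Γ_ℚ` is the tree's `absGaloisRestrict`, `ρ̄|_{Γ_{ℚ_p}} = ρ̄.toLocal v`);
  clause (2) is taken AFTER EVERY EXTENSION OF SCALARS `k →+* k'` — STRONGER than the printed
  `k`-rational clause (the printed `ρ̄` is valued in a finite field `𝔽 ⊇ 𝔽_p`), hence the fact below
  assumes more and asserts the printed conclusion in a special case (D-0064).
* `UniversalDeformationHeckeAlgebra.nonempty` — THE NAMED FACT: for `p` odd, `k` a coefficient field
  with `ℤ_p ↠ k` (so `k = 𝔽_p`; discrete), `S ∋ p`, and `ρ̄ : Γ_ℚ →ₜ* GL₂(k)` absolutely irreducible,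
  unramified outside `S`, MODULAR of tame level in `S` (some classical Hecke eigensystem of weight
  `≥ 2` and level with prime factors in `S` reduces to `tr ρ̄(Frob_ℓ)`, `ℓ ∉ S` — the allowable level
  of §2.1) and satisfying Assumption 2.1, the interface `UniversalDeformationHeckeAlgebra p ℤ_[p] k S ρ̄`
  is inhabited. This is the conjunction of the printed §2.1 (Carayol), Prop. 2.4 (flat), Cor. 2.5
  (reduced), Prop. 2.6 (`R_Σ ≅ T`, density) and [Fouquet2025EquivariantTNC] §2.4.1 (all levels at
  `p`, motivic points), exactly the fields of the interface (see that file's docstring, § "What is NOT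
  claimed", for the field-by-field concordance).

## Faithfulness notes

* SPECIAL CASE of the printed generality (D-0064 "the special case you need"): coefficients
  `𝒪 = ℤ_p`, `k = 𝔽_p` (the sources allow `𝒪 = 𝒪_L`, `k ⊇ 𝔽_p` finite); this is the case of the
  requesting route (`ρ̄ = ρ̄_{E,3} : Γ_ℚ → GL₂(𝔽₃)`).
  -- TODO(general form): `𝒪 = 𝒪_L` the integers of a finite `L/ℚ_p` inside `ℚ̄_p`, `k = 𝒪_L/λ`.
* HYPOTHESES: `S` is a finite set of PRIMES containing `p` (printed: "a finite set of finite primes";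
  a `0 ∈ S` would make "unramified outside `S`" vacuous, whence the explicit primality binder);
  absolute irreducibility of `ρ̄` is kept although implied by Assumption 2.1 (1); oddness is implied by
  modularity and is not a hypothesis in print either; Assumption 2.1 (2) is taken in its absolute form
  (STRONGER than print, see `FouquetWan2021Assumption21`), so the fact assumes more than the source
  and concludes the same.
* `[DiscreteTopology k]`: `ρ̄` is a genuine (continuous, open-kernel) residual representation.
* [FouquetWan2021] is an arXiv preprint (v3, 2022; no journal version as of 2026-08): the `R = T` and
  density statements it packages are attributed there to Böckle, Diamond–Flach–Guo, Kisin,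
  Gouvêa–Mazur and Carayol (§2.2.2, proofs of Prop. 2.4–2.6); the refereed [Fouquet2025EquivariantTNC]
  §2.4.1 states the same package under its Ass. 2.9. Consumers who need only the SL₂-image variant
  should file that variant separately rather than weaken this one.

## References

* [FouquetWan2021] O. Fouquet, X. Wan, arXiv:2107.13726v3, §2.1 (p. 12), Assumption 2.1 (p. 13),
  Prop. 2.4 (p. 14), Cor. 2.5 (p. 15), Prop. 2.6 (p. 16). [corpus: paper-arxiv-2107.13726 p0012–p0016]
* [Fouquet2025EquivariantTNC] O. Fouquet, Tunisian J. Math. 7 (2025) 791–829, §2.4.1, Ass. 2.9 (p. 15).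
  [corpus: paper-arxiv-2501.07105 p0015]
* Tree: `UniversalDeformationHeckeAlgebra.lean` (the interface and the eigensystem predicates),
  `ModPGaloisRep.lean` (`modPCyclotomicCharacterZMod`),
  `ResidualGaloisRep.lean` (`IsAbsIrreducible`), `CalegariEvenFontaineMazurTwo.lean` (the same two
  Taylor–Wiles-type idioms for Calegari's hypotheses), `CrystallineDeformationRing.lean`
  (`CrystallineDeformationRing.nonempty`: the shape of an existence fact for an interface).
-/

noncomputable section

open scoped NumberField MatrixGroups
open Field IsDedekindDomain IsLocalRing

namespace Literature.NumberTheory.GaloisRepresentations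

/-! ### Assumption 2.1 of Fouquet–Wan -/

/-- **`G_{ℚ(√p*)} ≤ Γ_ℚ`** (`p* = (−1)^{(p−1)/2} p`, `p` odd): the kernel of the quadratic character
`σ ↦ χ̄_cyc(σ)^{(p−1)/2}` of `Γ_ℚ`, `χ̄_cyc : Γ_ℚ → 𝔽_p^×` the mod-`p` cyclotomic character
(`modPCyclotomicCharacterZMod`) — its fixed field is the unique quadratic subfield `ℚ(√p*)` of
`ℚ(ζ_p)`, the squares being the unique index-two subgroup of the cyclic group `𝔽_p^×`.
[cite: FouquetWan2021, Assumption 2.1 (p. 13)] -/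
def galSqrtPStar (p : ℕ) [Fact p.Prime] : Subgroup (absoluteGaloisGroup ℚ) :=
  ((powMonoidHom ((p - 1) / 2)).comp (modPCyclotomicCharacterZMod ℚ p)).ker

/-- Membership in `galSqrtPStar p`: `χ̄_cyc(σ)^{(p−1)/2} = 1`. [cite: FouquetWan2021, Assumption 2.1 (p. 13)] -/
theorem mem_galSqrtPStar_iff (p : ℕ) [Fact p.Prime] (σ : absoluteGaloisGroup ℚ) :
    σ ∈ galSqrtPStar p ↔ modPCyclotomicCharacterZMod ℚ p σ ^ ((p - 1) / 2) = 1 :=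
  Iff.rfl

/-- **Assumption 2.1 of [FouquetWan2021]** (`(HypTW)` there) for `ρ̄ : Γ_ℚ →ₜ* GL₂(k)`, `k` of
characteristic `p` (the printed `ρ̄` is valued in a finite extension `𝔽` of `𝔽_p`, p. 2, p. 12).
(1) "If `p* = (−1)^{(p−1)/2} p`, then `ρ̄|G_{ℚ(√p*)}` is absolutely irreducible" — the restriction of
`ρ̄` to `galSqrtPStar p` is absolutely irreducible (`IsAbsIrreducible`), faithful. (2) "If `ρ̄|G_{ℚ_p}`
is an extension `0 → χ₁ → ρ̄|G_{ℚ_p} → χ₂ → 0`, then `χ₁⁻¹χ₂ ∉ {1, χ̄_cyc}`" — transcribed AFTER EVERY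
EXTENSION OF SCALARS `f : k →+* k'`: at the place `v ∣ p` (`ρ̄|_{Γ_{ℚ_p}} = ρ̄.toLocal v` along the
tree's `absGaloisRestrict`), for every field `k'` with `f : k →+* k'`, every frame `P ∈ GL₂(k')` and
characters `χ₁ χ₂ : Γ_{ℚ_p} → k'ˣ` such that `P⁻¹ f(ρ̄(g)) P` is upper triangular with diagonal
`(χ₁(g), χ₂(g))` for all `g ∈ Γ_{ℚ_p}` (`χ₁` on the stable line = the sub, `χ₂` the quotient),
`χ₁⁻¹χ₂ ≠ 1` and `χ₁⁻¹χ₂ ≠ χ̄_cyc|_{Γ_{ℚ_p}}` (the mod-`p` cyclotomic character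
`modPCyclotomicCharacterZMod`, read in `k'` through any `ι' : ZMod p →+* k'`, which exists and is
unique as `char k = p`). This clause is STRONGER than the printed `k`-rational clause (it also excludes
a `ρ̄|G_{ℚ_p}` irreducible over `k` that becomes such an extension over some `k'`, e.g. an induced
representation with ratio `χ̄_cyc` over `𝔽_{p²}`) — a SPECIAL CASE of the printed hypothesis set
(D-0064), chosen as the reading that is safe under base change of `ρ̄`; it is NOT verbatim.
([Fouquet2025EquivariantTNC] Ass. 2.9 (2) is the same printed condition: "`χψ⁻¹ ≠ 1` and
`χψ⁻¹ ≠ χ̄_cyc⁻¹`" with `χ` the sub, `ψ` the quotient.)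
[cite: FouquetWan2021, Assumption 2.1 (p. 13)] [cite: Fouquet2025EquivariantTNC, Ass. 2.9 (p. 15)] -/
def FouquetWan2021Assumption21 (p : ℕ) [Fact p.Prime] {k : Type} [Field k] [CharP k p]
    [TopologicalSpace k] (ρbar : FramedGaloisRep ℚ k 2) : Prop :=
  IsAbsIrreducible
      ((ρbar : absoluteGaloisGroup ℚ →* GL (Fin 2) k).comp (galSqrtPStar p).subtype) ∧
    ∀ (v : HeightOneSpectrum (𝓞 ℚ)), ((p : ℕ) : 𝓞 ℚ) ∈ v.asIdeal →
      ∀ (k' : Type) [Field k'] (f : k →+* k') (ι' : ZMod p →+* k') (P : GL (Fin 2) k')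
        (χ₁ χ₂ : absoluteGaloisGroup (v.adicCompletion ℚ) →* k'ˣ),
        (∀ g : absoluteGaloisGroup (v.adicCompletion ℚ),
          ((P⁻¹ * Matrix.GeneralLinearGroup.map f (ρbar.toLocal v g) * P : GL (Fin 2) k') :
              Matrix (Fin 2) (Fin 2) k') 1 0 = 0 ∧
            ((P⁻¹ * Matrix.GeneralLinearGroup.map f (ρbar.toLocal v g) * P : GL (Fin 2) k') :
              Matrix (Fin 2) (Fin 2) k') 0 0 = (χ₁ g : k') ∧
            ((P⁻¹ * Matrix.GeneralLinearGroup.map f (ρbar.toLocal v g) * P : GL (Fin 2) k') :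
              Matrix (Fin 2) (Fin 2) k') 1 1 = (χ₂ g : k')) →
        χ₁⁻¹ * χ₂ ≠ 1 ∧
          χ₁⁻¹ * χ₂ ≠ (Units.map (ι' : ZMod p →* k')).comp
            ((modPCyclotomicCharacterZMod ℚ p).comp
              (absGaloisRestrict ℚ (v.adicCompletion ℚ)).toMonoidHom)

/-! ### The construction statement -/

/-- **Existence of `T^Σ_𝔪ρ̄ ≅ R_Σ(ρ̄)` with the properties of the interface** — the conjunction of
[FouquetWan2021] §2.1 (Carayol's `ρ_Σ`, `tr ρ_Σ(Fr(ℓ)) = T(ℓ)`; `T^Σ_𝔪ρ̄` topologically generated by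
the `T(ℓ)`, p. 14), Prop. 2.4 ("`R_Σ(ρ̄)` is a flat `𝒪`-algebra which is a complete intersection ring
of Krull dimension 4"), Cor. 2.5 ("`R_Σ(ρ̄)` is reduced"), Prop. 2.6 ("The set of primes classical up
to a twist is Zariski-dense in `Spec R_Σ(ρ̄)`. In particular, `R_Σ(ρ̄)` and `T^Σ_𝔪ρ̄` are
isomorphic." — the source of the `R = T` field) and [Fouquet2025EquivariantTNC] §2.4.1
(`T^Σ_𝔪ρ̄ = lim←_{U_p} T(U_pU^{(p)})_{𝔪ρ̄}`: all levels at `p`, weight-independence, motivic points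
Zariski-dense), under the printed hypotheses: `p` an odd prime; `Σ = S ∋ p` a finite set of PRIMES
(binder `∀ ℓ ∈ S, ℓ.Prime`: "a finite set of finite primes", §2.1); `ρ̄ : G_ℚ → GL₂(k)` (here `k = 𝔽_p`: a discrete field with `ℤ_p ↠ k`) absolutely irreducible,
unramified outside `S`, MODULAR of an allowable level (some normalised eigen-cuspform of weight `≥ 2`
and level with prime factors in `S` has its `T(ℓ)`-eigenvalues, `ℓ ∉ S`, congruent to `tr ρ̄(Frob_ℓ)`:
"there exists a maximal ideal `𝔪_ρ̄` … `T(ℓ) mod 𝔪_ρ̄ = tr ρ̄(Fr(ℓ))`", §2.1), and satisfying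
Assumption 2.1 (`FouquetWan2021Assumption21`; clause (2) in its absolute form, STRONGER than print, so
this fact assumes more than the source and concludes the same). Conclusion: the interface
`UniversalDeformationHeckeAlgebra p ℤ_[p] k S ρ̄` is inhabited. Special case `𝒪 = ℤ_p`, `k = 𝔽_p` of the
printed coefficients (see the module docstring). A named fact (D-0014); nothing is proved here.
[cite: FouquetWan2021, §2.1 (p. 12), Prop. 2.4 (p. 14), Cor. 2.5 (p. 15), Prop. 2.6 (p. 16)] [cite: Fouquet2025EquivariantTNC, §2.4.1 (p. 15)] -/
def UniversalDeformationHeckeAlgebra.nonempty : Prop :=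
  ∀ (p : ℕ) [Fact p.Prime], p ≠ 2 →
  ∀ (k : Type) [Field k] [CharP k p] [Algebra ℤ_[p] k] [TopologicalSpace k] [DiscreteTopology k],
    Function.Surjective (algebraMap ℤ_[p] k) →
  ∀ (S : Finset ℕ), (∀ ℓ ∈ S, ℓ.Prime) → p ∈ S →
  ∀ (ρbar : FramedGaloisRep ℚ k 2),
    IsAbsIrreducible (ρbar : absoluteGaloisGroup ℚ →* GL (Fin 2) k) →
    (∀ v : HeightOneSpectrum (𝓞 ℚ), (∀ ℓ ∈ S, ((ℓ : ℕ) : 𝓞 ℚ) ∉ v.asIdeal) → ρbar.IsUnramifiedAt v) →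
    (∃ b : ℕ → PadicAlgCl p,
      IsClassicalHeckeEigensystem p S b ∧ HeckeEigensystemReducesTo ℤ_[p] S ρbar b) →
    FouquetWan2021Assumption21 p ρbar →
      Nonempty (UniversalDeformationHeckeAlgebra p ℤ_[p] k S ρbar)

end Literature.NumberTheory.GaloisRepresentations
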